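import Summits.AtomisticToContinuum.FouriersLaw.Theorems.HonestZwanzigPositiveMemoryDetG0NeZero
import Summits.AtomisticToContinuum.FouriersLaw.Theorems.HonestZwanzigPositiveMemoryLapZeroFlat
import Summits.AtomisticToContinuum.FouriersLaw.Theorems.HonestZwanzigPositiveMemoryGreenKuboFloorBridges
import Summits.AtomisticToContinuum.FouriersLaw.Theorems.HonestZwanzigPositiveMemorySchurZeroFloorOfFloors
import Summits.AtomisticToContinuum.FouriersLaw.Theorems.HonestZwanzigPositiveMemoryNotInsulating
import Summits.AtomisticToContinuum.FouriersLaw.Theorems.HonestZwanzigPositiveMemoryRowLimit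
import Summits.AtomisticToContinuum.FouriersLaw.Theorems.HonestZwanzigPositiveMemoryBackflowFloorOfOrthogonalOhm
import Summits.AtomisticToContinuum.FouriersLaw.Theorems.HonestZwanzigMemoryConductivityBridges
import Summits.AtomisticToContinuum.FouriersLaw.Theorems.HonestZwanzigNetworkReduction

/-!
# HonestZwanzig / PositiveMemory — the crux in EXISTENCE-FREE NORMAL FORM and its two-floor decomposition
# (line `Sketch`, skeleton v10/v11 compositions; lead c8, cycle 10, 2026-08-17)

Support file for crux item `stmt-AtomisticToContinuum-12694` (`HonestZwanzig.PositiveMemory`, rank 3 of route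
`HonestZwanzig`, sub-problem `FouriersLaw`). All five stubs of skeleton v10 are landed (`stub_detG0NeZero` p152568,
`stub_lapZeroFlat` p152799, `stub_eventualFloor_of_conductanceLowerBound` + `stub_eventualFloor_of_fouriersLaw` p153109,
`stub_schur0Floor_of_floors` p153410); this file composes them with the landed v6–v9 theorems into the statements a
planner can quote BY NAME:

* `bulkBackflowFloor_of_floor0` / `bulkBackflowFloor0_of_floor` — the bulk backflow floor of line `Sketch` (child 2 of
  the strategist's prepared split, `Cruxes/PositiveMemory/SPLIT-READY.md`) is EQUIVALENT to its existence-free form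
  "`∫₀^∞corr(J,J)/(N−1) − δ ≤ schur₀(j_b, J)` on `R(δ)`-bulk bonds" (every limit exists: `tendsto_schur_bond_all`,
  p152568; Kirchhoff flatness: `stub_rowLimit`, p122092);
* `bulkBackflowFloor0_of_orthogonalOhm` — crux #2 implies it (one line from p122152);
* `PositiveMemory_of_floors0` — **`EventualGreenKuboFloor → BulkBackflowFloor₀ → PositiveMemory`**: the crux from the
  two existence-free, Schur-light floors, with NO reference to crux #2 and none to steady states; both floors are
  necessary given crux #2 (`stub_eventualFloor_of_fouriersLaw`: `FouriersLaw → EGKF`; `OO → BBF₀`) — the recommended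
  pair of children for a split of crux #3 (glue-by this decl), alternative to the pair (stmt-11749 verbatim, BBF);
* `PositiveMemory_of_floors` — the same with the existence-guarded `BulkBackflowFloor` of v8/v9;
* `PositiveMemory_of_eventualFloor` / `eventualFloor_of_cruxes` / `positiveMemory_iff_eventualFloor` — given crux #2
  (and #4 for `→`), crux #3 IS the eventual Green–Kubo floor `∃ κ > 0, κ(N−1) ≤ ∫₀^∞corr_N(J,J)` eventually;
* `PositiveMemory_of_fouriersLaw` — necessity: `OrthogonalOhm → FouriersLaw → PositiveMemory` (landed pieces only), so
  `¬PositiveMemory → OrthogonalOhm → ¬FouriersLaw`;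
* (the skeleton theorem `OrthogonalOhm → ConductanceLowerBound → PositiveMemory` through the normal form is the one-liner
  `PositiveMemory_of_floors0 (stub_eventualFloor_of_conductanceLowerBound hCLB) (bulkBackflowFloor0_of_orthogonalOhm hOO)`;
  as a TYPE it is already landed twice — `PositiveMemory_of_notInsulating` p120416, `PositiveMemory_of_subs'` p149463 —
  so it is not restated here.)

Formal status of the crux (unchanged by this file): closed MODULO the existing items stmt-AtomisticToContinuum-11749
(`ConductanceLowerBound`) ∧ (stmt-AtomisticToContinuum-12693 `OrthogonalOhm` ∨ the bulk backflow floor).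
No definitions, no named facts, no `sorry`.
-/

noncomputable section

open MeasureTheory Finset Real Set Filter Topology
open Literature.MathematicalPhysics.KineticTheory.HeatConduction
open Summit.AtomisticToContinuum.FouriersLaw.Theorems.HonestZwanzig.NetworkReduction

namespace Summit.AtomisticToContinuum.FouriersLaw.Theorems.HonestZwanzig.PositiveMemory

/-- **The existence-free bulk backflow floor implies the guarded one.** Given limits `ρ`, `ℓ` on an `R`-bulk (hence
genuine) bond, uniqueness of limits in the `NeBot` filter `𝓝[>] 0` identifies `ρ = schur₀(j_b,J)` (`tendsto_schur_bond_all`,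
p152568) and `ℓ = ∫₀^∞corr(J,J)/(N−1)` (`stub_rowLimit`, p122092). -/
theorem bulkBackflowFloor_of_floor0 :
    (∀ ω₂ lam β γ : ℝ, 0 < ω₂ → 0 < lam → 0 < β → 0 < γ → ∀ T : ℝ, 0 < T → ∀ δ : ℝ, 0 < δ → ∃ R : ℕ, ∀ N : ℕ, 2 ≤ N →
      let P := Literature.MathematicalPhysics.KineticTheory.HeatConduction.pinnedChain ω₂ lam β γ
      let X := Literature.MathematicalPhysics.KineticTheory.HeatConduction.PhaseSpace N
      let μ : MeasureTheory.Measure X := P.gibbsMeasure N T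
      let corr : (X → ℝ) → (X → ℝ) → ℝ → ℝ := fun f g t =>
        (∫ z, f z * (∫ y, g y ∂(P.transitionKernel N T T t.toNNReal z)) ∂μ) - (∫ z, f z ∂μ) * (∫ z, g z ∂μ)
      let e : Fin N → X → ℝ := fun x z => z.2 x ^ 2 / 2 + P.U (z.1 x) +
        ∑ j : Fin N, ((if j.val = x.val + 1 then P.V (z.1 j - z.1 x) / 2 else 0) +
          (if x.val = j.val + 1 then P.V (z.1 x - z.1 j) / 2 else 0))
      let J : X → ℝ := fun z => ∑ i : Fin N, P.bondCurrent N i z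
      let G₀ : Matrix (Fin N) (Fin N) ℝ := Matrix.of fun x y => ∫ t in Set.Ioi (0 : ℝ), corr (e x) (e y) t
      let schur₀ : (X → ℝ) → (X → ℝ) → ℝ := fun f g =>
        (∫ t in Set.Ioi (0 : ℝ), corr f g t) -
          ∑ x : Fin N, ∑ y : Fin N, (∫ t in Set.Ioi (0 : ℝ), corr f (e x) t) * G₀⁻¹ x y *
            (∫ t in Set.Ioi (0 : ℝ), corr (e y) g t)
      ∀ b : Fin N, R ≤ b.val → b.val + 2 + R ≤ N →
        (∫ t in Set.Ioi (0 : ℝ), corr J J t) / ((N : ℝ) - 1) - δ ≤ schur₀ (P.bondCurrent N b) J) →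
    (∀ ω₂ lam β γ : ℝ, 0 < ω₂ → 0 < lam → 0 < β → 0 < γ → ∀ T : ℝ, 0 < T → ∀ δ : ℝ, 0 < δ → ∃ R : ℕ, ∀ N : ℕ, 2 ≤ N →
    let P := Literature.MathematicalPhysics.KineticTheory.HeatConduction.pinnedChain ω₂ lam β γ;
    let X := Literature.MathematicalPhysics.KineticTheory.HeatConduction.PhaseSpace N;
    let μ : MeasureTheory.Measure X := P.gibbsMeasure N T;
    let corr : (X → ℝ) → (X → ℝ) → ℝ → ℝ := fun f g t =>
      (∫ z, f z * (∫ y, g y ∂(P.transitionKernel N T T t.toNNReal z)) ∂μ) - (∫ z, f z ∂μ) * (∫ z, g z ∂μ);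
    let lap : ℝ → (X → ℝ) → (X → ℝ) → ℝ := fun s f g =>
      ∫ t in Set.Ioi (0 : ℝ), Real.exp (-(s * t)) * corr f g t;
    let e : Fin N → X → ℝ := fun x z => z.2 x ^ 2 / 2 + P.U (z.1 x) +
      ∑ j : Fin N, ((if j.val = x.val + 1 then P.V (z.1 j - z.1 x) / 2 else 0) +
        (if x.val = j.val + 1 then P.V (z.1 x - z.1 j) / 2 else 0));
    let G : ℝ → Matrix (Fin N) (Fin N) ℝ := fun s => Matrix.of fun x y => lap s (e x) (e y);
    let schur : ℝ → (X → ℝ) → (X → ℝ) → ℝ := fun s f g =>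
      lap s f g - ∑ x : Fin N, ∑ y : Fin N, lap s f (e x) * (G s)⁻¹ x y * lap s (e y) g;
    let J : X → ℝ := fun z => ∑ i : Fin N, P.bondCurrent N i z;
    ∀ b : Fin N, R ≤ b.val → b.val + 2 + R ≤ N → ∀ ρ ℓ : ℝ,
      Filter.Tendsto (fun s => schur s (P.bondCurrent N b) J) (nhdsWithin (0 : ℝ) (Set.Ioi 0)) (nhds ρ) →
      Filter.Tendsto (fun s => lap s (P.bondCurrent N b) J) (nhdsWithin (0 : ℝ) (Set.Ioi 0)) (nhds ℓ) →
      ℓ - δ ≤ ρ) := by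
  intro h₀ ω₂ lam β γ hω hl hβ hγ T hT δ hδ
  obtain ⟨R, hR⟩ := h₀ ω₂ lam β γ hω hl hβ hγ T hT δ hδ
  refine ⟨R, fun N hN => ?_⟩
  have key := hR N hN
  have hex := tendsto_schur_bond_all ω₂ lam β γ hω hl hβ hγ T hT N hN
  have hrow := stub_rowLimit Summit.AtomisticToContinuum.FouriersLaw.Theorems.HonestZwanzig.stub_feshbachIdentities
    ω₂ lam β γ hω hl hβ hγ T hT N hN
  dsimp only at key hex hrow ⊢
  intro b hRb hbN ρ ℓ hρ hℓ
  have hb : b.val + 1 < N := by omega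
  have hρeq : ρ = _ := tendsto_nhds_unique hρ (hex b)
  have hℓeq : ℓ = _ := tendsto_nhds_unique hℓ (hrow b hb)
  rw [hρeq, hℓeq]
  exact key b hRb hbN

/-- **The guarded bulk backflow floor implies the existence-free one**: instantiate it at the limits, which exist
(`tendsto_schur_bond_all`, p152568; `stub_rowLimit`, p122092). -/
theorem bulkBackflowFloor0_of_floor :
    (∀ ω₂ lam β γ : ℝ, 0 < ω₂ → 0 < lam → 0 < β → 0 < γ → ∀ T : ℝ, 0 < T → ∀ δ : ℝ, 0 < δ → ∃ R : ℕ, ∀ N : ℕ, 2 ≤ N →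
    let P := Literature.MathematicalPhysics.KineticTheory.HeatConduction.pinnedChain ω₂ lam β γ;
    let X := Literature.MathematicalPhysics.KineticTheory.HeatConduction.PhaseSpace N;
    let μ : MeasureTheory.Measure X := P.gibbsMeasure N T;
    let corr : (X → ℝ) → (X → ℝ) → ℝ → ℝ := fun f g t =>
      (∫ z, f z * (∫ y, g y ∂(P.transitionKernel N T T t.toNNReal z)) ∂μ) - (∫ z, f z ∂μ) * (∫ z, g z ∂μ);
    let lap : ℝ → (X → ℝ) → (X → ℝ) → ℝ := fun s f g =>
      ∫ t in Set.Ioi (0 : ℝ), Real.exp (-(s * t)) * corr f g t;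
    let e : Fin N → X → ℝ := fun x z => z.2 x ^ 2 / 2 + P.U (z.1 x) +
      ∑ j : Fin N, ((if j.val = x.val + 1 then P.V (z.1 j - z.1 x) / 2 else 0) +
        (if x.val = j.val + 1 then P.V (z.1 x - z.1 j) / 2 else 0));
    let G : ℝ → Matrix (Fin N) (Fin N) ℝ := fun s => Matrix.of fun x y => lap s (e x) (e y);
    let schur : ℝ → (X → ℝ) → (X → ℝ) → ℝ := fun s f g =>
      lap s f g - ∑ x : Fin N, ∑ y : Fin N, lap s f (e x) * (G s)⁻¹ x y * lap s (e y) g;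
    let J : X → ℝ := fun z => ∑ i : Fin N, P.bondCurrent N i z;
    ∀ b : Fin N, R ≤ b.val → b.val + 2 + R ≤ N → ∀ ρ ℓ : ℝ,
      Filter.Tendsto (fun s => schur s (P.bondCurrent N b) J) (nhdsWithin (0 : ℝ) (Set.Ioi 0)) (nhds ρ) →
      Filter.Tendsto (fun s => lap s (P.bondCurrent N b) J) (nhdsWithin (0 : ℝ) (Set.Ioi 0)) (nhds ℓ) →
      ℓ - δ ≤ ρ) →
    (∀ ω₂ lam β γ : ℝ, 0 < ω₂ → 0 < lam → 0 < β → 0 < γ → ∀ T : ℝ, 0 < T → ∀ δ : ℝ, 0 < δ → ∃ R : ℕ, ∀ N : ℕ, 2 ≤ N →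
      let P := Literature.MathematicalPhysics.KineticTheory.HeatConduction.pinnedChain ω₂ lam β γ
      let X := Literature.MathematicalPhysics.KineticTheory.HeatConduction.PhaseSpace N
      let μ : MeasureTheory.Measure X := P.gibbsMeasure N T
      let corr : (X → ℝ) → (X → ℝ) → ℝ → ℝ := fun f g t =>
        (∫ z, f z * (∫ y, g y ∂(P.transitionKernel N T T t.toNNReal z)) ∂μ) - (∫ z, f z ∂μ) * (∫ z, g z ∂μ)
      let e : Fin N → X → ℝ := fun x z => z.2 x ^ 2 / 2 + P.U (z.1 x) +
        ∑ j : Fin N, ((if j.val = x.val + 1 then P.V (z.1 j - z.1 x) / 2 else 0) +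
          (if x.val = j.val + 1 then P.V (z.1 x - z.1 j) / 2 else 0))
      let J : X → ℝ := fun z => ∑ i : Fin N, P.bondCurrent N i z
      let G₀ : Matrix (Fin N) (Fin N) ℝ := Matrix.of fun x y => ∫ t in Set.Ioi (0 : ℝ), corr (e x) (e y) t
      let schur₀ : (X → ℝ) → (X → ℝ) → ℝ := fun f g =>
        (∫ t in Set.Ioi (0 : ℝ), corr f g t) -
          ∑ x : Fin N, ∑ y : Fin N, (∫ t in Set.Ioi (0 : ℝ), corr f (e x) t) * G₀⁻¹ x y *
            (∫ t in Set.Ioi (0 : ℝ), corr (e y) g t)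
      ∀ b : Fin N, R ≤ b.val → b.val + 2 + R ≤ N →
        (∫ t in Set.Ioi (0 : ℝ), corr J J t) / ((N : ℝ) - 1) - δ ≤ schur₀ (P.bondCurrent N b) J) := by
  intro h ω₂ lam β γ hω hl hβ hγ T hT δ hδ
  obtain ⟨R, hR⟩ := h ω₂ lam β γ hω hl hβ hγ T hT δ hδ
  refine ⟨R, fun N hN => ?_⟩
  have key := hR N hN
  have hex := tendsto_schur_bond_all ω₂ lam β γ hω hl hβ hγ T hT N hN
  have hrow := stub_rowLimit Summit.AtomisticToContinuum.FouriersLaw.Theorems.HonestZwanzig.stub_feshbachIdentities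
    ω₂ lam β γ hω hl hβ hγ T hT N hN
  dsimp only at key hex hrow ⊢
  intro b hRb hbN
  have hb : b.val + 1 < N := by omega
  exact key b hRb hbN _ _ (hex b) (hrow b hb)

/-- **Crux #2 implies the existence-free bulk backflow floor** (`stub_backflowFloor_of_orthogonalOhm`, p122152, fed the
landed `stub_feshbachIdentities` / `stub_rowLimit`, then `bulkBackflowFloor0_of_floor`). -/
theorem bulkBackflowFloor0_of_orthogonalOhm
    (hOO : Summit.AtomisticToContinuum.FouriersLaw.Theses.HonestZwanzig.OrthogonalOhm) :
    (∀ ω₂ lam β γ : ℝ, 0 < ω₂ → 0 < lam → 0 < β → 0 < γ → ∀ T : ℝ, 0 < T → ∀ δ : ℝ, 0 < δ → ∃ R : ℕ, ∀ N : ℕ, 2 ≤ N →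
      let P := Literature.MathematicalPhysics.KineticTheory.HeatConduction.pinnedChain ω₂ lam β γ
      let X := Literature.MathematicalPhysics.KineticTheory.HeatConduction.PhaseSpace N
      let μ : MeasureTheory.Measure X := P.gibbsMeasure N T
      let corr : (X → ℝ) → (X → ℝ) → ℝ → ℝ := fun f g t =>
        (∫ z, f z * (∫ y, g y ∂(P.transitionKernel N T T t.toNNReal z)) ∂μ) - (∫ z, f z ∂μ) * (∫ z, g z ∂μ)
      let e : Fin N → X → ℝ := fun x z => z.2 x ^ 2 / 2 + P.U (z.1 x) +
        ∑ j : Fin N, ((if j.val = x.val + 1 then P.V (z.1 j - z.1 x) / 2 else 0) +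
          (if x.val = j.val + 1 then P.V (z.1 x - z.1 j) / 2 else 0))
      let J : X → ℝ := fun z => ∑ i : Fin N, P.bondCurrent N i z
      let G₀ : Matrix (Fin N) (Fin N) ℝ := Matrix.of fun x y => ∫ t in Set.Ioi (0 : ℝ), corr (e x) (e y) t
      let schur₀ : (X → ℝ) → (X → ℝ) → ℝ := fun f g =>
        (∫ t in Set.Ioi (0 : ℝ), corr f g t) -
          ∑ x : Fin N, ∑ y : Fin N, (∫ t in Set.Ioi (0 : ℝ), corr f (e x) t) * G₀⁻¹ x y *
            (∫ t in Set.Ioi (0 : ℝ), corr (e y) g t)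
      ∀ b : Fin N, R ≤ b.val → b.val + 2 + R ≤ N →
        (∫ t in Set.Ioi (0 : ℝ), corr J J t) / ((N : ℝ) - 1) - δ ≤ schur₀ (P.bondCurrent N b) J) :=
  bulkBackflowFloor0_of_floor
    (stub_backflowFloor_of_orthogonalOhm
      Summit.AtomisticToContinuum.FouriersLaw.Theorems.HonestZwanzig.stub_feshbachIdentities
      (stub_rowLimit Summit.AtomisticToContinuum.FouriersLaw.Theorems.HonestZwanzig.stub_feshbachIdentities) hOO)

/-- **`EventualGreenKuboFloor → BulkBackflowFloor₀ → PositiveMemory`** — the crux from the two EXISTENCE-FREE floors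
(bookkeeping `stub_schur0Floor_of_floors`, p153410, then the normal form `positiveMemory_iff_schur0Floor`, p152568).
No reference to crux #2, none to steady states; both hypotheses are necessary given crux #2. This is the glue of the
recommended split of crux #3 into (eventual Green–Kubo floor, existence-free bulk backflow floor). -/
theorem PositiveMemory_of_floors0 :
    (∀ ω₂ lam β γ : ℝ, 0 < ω₂ → 0 < lam → 0 < β → 0 < γ → ∀ T : ℝ, 0 < T →
      ∃ κ : ℝ, 0 < κ ∧ ∃ N₀ : ℕ, ∀ N : ℕ, N₀ ≤ N → 2 ≤ N →
      let P := Literature.MathematicalPhysics.KineticTheory.HeatConduction.pinnedChain ω₂ lam β γ;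
      let X := Literature.MathematicalPhysics.KineticTheory.HeatConduction.PhaseSpace N;
      let μ : MeasureTheory.Measure X := P.gibbsMeasure N T;
      let J : X → ℝ := fun z => ∑ i : Fin N, P.bondCurrent N i z;
      κ * ((N : ℝ) - 1) ≤ ∫ t in Set.Ioi (0 : ℝ),
        ((∫ z, J z * (∫ y, J y ∂(P.transitionKernel N T T t.toNNReal z)) ∂μ) - (∫ z, J z ∂μ) * (∫ z, J z ∂μ))) →
    (∀ ω₂ lam β γ : ℝ, 0 < ω₂ → 0 < lam → 0 < β → 0 < γ → ∀ T : ℝ, 0 < T → ∀ δ : ℝ, 0 < δ → ∃ R : ℕ, ∀ N : ℕ, 2 ≤ N →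
      let P := Literature.MathematicalPhysics.KineticTheory.HeatConduction.pinnedChain ω₂ lam β γ
      let X := Literature.MathematicalPhysics.KineticTheory.HeatConduction.PhaseSpace N
      let μ : MeasureTheory.Measure X := P.gibbsMeasure N T
      let corr : (X → ℝ) → (X → ℝ) → ℝ → ℝ := fun f g t =>
        (∫ z, f z * (∫ y, g y ∂(P.transitionKernel N T T t.toNNReal z)) ∂μ) - (∫ z, f z ∂μ) * (∫ z, g z ∂μ)
      let e : Fin N → X → ℝ := fun x z => z.2 x ^ 2 / 2 + P.U (z.1 x) +
        ∑ j : Fin N, ((if j.val = x.val + 1 then P.V (z.1 j - z.1 x) / 2 else 0) +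
          (if x.val = j.val + 1 then P.V (z.1 x - z.1 j) / 2 else 0))
      let J : X → ℝ := fun z => ∑ i : Fin N, P.bondCurrent N i z
      let G₀ : Matrix (Fin N) (Fin N) ℝ := Matrix.of fun x y => ∫ t in Set.Ioi (0 : ℝ), corr (e x) (e y) t
      let schur₀ : (X → ℝ) → (X → ℝ) → ℝ := fun f g =>
        (∫ t in Set.Ioi (0 : ℝ), corr f g t) -
          ∑ x : Fin N, ∑ y : Fin N, (∫ t in Set.Ioi (0 : ℝ), corr f (e x) t) * G₀⁻¹ x y *
            (∫ t in Set.Ioi (0 : ℝ), corr (e y) g t)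
      ∀ b : Fin N, R ≤ b.val → b.val + 2 + R ≤ N →
        (∫ t in Set.Ioi (0 : ℝ), corr J J t) / ((N : ℝ) - 1) - δ ≤ schur₀ (P.bondCurrent N b) J) →
    Summit.AtomisticToContinuum.FouriersLaw.Theses.HonestZwanzig.PositiveMemory :=
  fun hGK hB₀ => positiveMemory_iff_schur0Floor.mpr (stub_schur0Floor_of_floors hGK hB₀)

/-- **`EventualGreenKuboFloor → BulkBackflowFloor → PositiveMemory`** (guarded backflow floor of v8/v9). -/
theorem PositiveMemory_of_floors :
    (∀ ω₂ lam β γ : ℝ, 0 < ω₂ → 0 < lam → 0 < β → 0 < γ → ∀ T : ℝ, 0 < T →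
      ∃ κ : ℝ, 0 < κ ∧ ∃ N₀ : ℕ, ∀ N : ℕ, N₀ ≤ N → 2 ≤ N →
      let P := Literature.MathematicalPhysics.KineticTheory.HeatConduction.pinnedChain ω₂ lam β γ;
      let X := Literature.MathematicalPhysics.KineticTheory.HeatConduction.PhaseSpace N;
      let μ : MeasureTheory.Measure X := P.gibbsMeasure N T;
      let J : X → ℝ := fun z => ∑ i : Fin N, P.bondCurrent N i z;
      κ * ((N : ℝ) - 1) ≤ ∫ t in Set.Ioi (0 : ℝ),
        ((∫ z, J z * (∫ y, J y ∂(P.transitionKernel N T T t.toNNReal z)) ∂μ) - (∫ z, J z ∂μ) * (∫ z, J z ∂μ))) →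
    (∀ ω₂ lam β γ : ℝ, 0 < ω₂ → 0 < lam → 0 < β → 0 < γ → ∀ T : ℝ, 0 < T → ∀ δ : ℝ, 0 < δ → ∃ R : ℕ, ∀ N : ℕ, 2 ≤ N →
    let P := Literature.MathematicalPhysics.KineticTheory.HeatConduction.pinnedChain ω₂ lam β γ;
    let X := Literature.MathematicalPhysics.KineticTheory.HeatConduction.PhaseSpace N;
    let μ : MeasureTheory.Measure X := P.gibbsMeasure N T;
    let corr : (X → ℝ) → (X → ℝ) → ℝ → ℝ := fun f g t =>
      (∫ z, f z * (∫ y, g y ∂(P.transitionKernel N T T t.toNNReal z)) ∂μ) - (∫ z, f z ∂μ) * (∫ z, g z ∂μ);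
    let lap : ℝ → (X → ℝ) → (X → ℝ) → ℝ := fun s f g =>
      ∫ t in Set.Ioi (0 : ℝ), Real.exp (-(s * t)) * corr f g t;
    let e : Fin N → X → ℝ := fun x z => z.2 x ^ 2 / 2 + P.U (z.1 x) +
      ∑ j : Fin N, ((if j.val = x.val + 1 then P.V (z.1 j - z.1 x) / 2 else 0) +
        (if x.val = j.val + 1 then P.V (z.1 x - z.1 j) / 2 else 0));
    let G : ℝ → Matrix (Fin N) (Fin N) ℝ := fun s => Matrix.of fun x y => lap s (e x) (e y);
    let schur : ℝ → (X → ℝ) → (X → ℝ) → ℝ := fun s f g =>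
      lap s f g - ∑ x : Fin N, ∑ y : Fin N, lap s f (e x) * (G s)⁻¹ x y * lap s (e y) g;
    let J : X → ℝ := fun z => ∑ i : Fin N, P.bondCurrent N i z;
    ∀ b : Fin N, R ≤ b.val → b.val + 2 + R ≤ N → ∀ ρ ℓ : ℝ,
      Filter.Tendsto (fun s => schur s (P.bondCurrent N b) J) (nhdsWithin (0 : ℝ) (Set.Ioi 0)) (nhds ρ) →
      Filter.Tendsto (fun s => lap s (P.bondCurrent N b) J) (nhdsWithin (0 : ℝ) (Set.Ioi 0)) (nhds ℓ) →
      ℓ - δ ≤ ρ) →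
    Summit.AtomisticToContinuum.FouriersLaw.Theses.HonestZwanzig.PositiveMemory :=
  fun hGK hB => PositiveMemory_of_floors0 hGK (bulkBackflowFloor0_of_floor hB)

/-- **`OrthogonalOhm → EventualGreenKuboFloor → PositiveMemory`** (= `positiveMemory_of_greenKuboFloor`, p120416, with
`FeshbachIdentities` discharged): given crux #2, crux #3 is exactly the eventual Green–Kubo floor. -/
theorem PositiveMemory_of_eventualFloor
    (hOO : Summit.AtomisticToContinuum.FouriersLaw.Theses.HonestZwanzig.OrthogonalOhm) :
    (∀ ω₂ lam β γ : ℝ, 0 < ω₂ → 0 < lam → 0 < β → 0 < γ → ∀ T : ℝ, 0 < T →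
      ∃ κ : ℝ, 0 < κ ∧ ∃ N₀ : ℕ, ∀ N : ℕ, N₀ ≤ N → 2 ≤ N →
      let P := Literature.MathematicalPhysics.KineticTheory.HeatConduction.pinnedChain ω₂ lam β γ;
      let X := Literature.MathematicalPhysics.KineticTheory.HeatConduction.PhaseSpace N;
      let μ : MeasureTheory.Measure X := P.gibbsMeasure N T;
      let J : X → ℝ := fun z => ∑ i : Fin N, P.bondCurrent N i z;
      κ * ((N : ℝ) - 1) ≤ ∫ t in Set.Ioi (0 : ℝ),
        ((∫ z, J z * (∫ y, J y ∂(P.transitionKernel N T T t.toNNReal z)) ∂μ) - (∫ z, J z ∂μ) * (∫ z, J z ∂μ))) →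
    Summit.AtomisticToContinuum.FouriersLaw.Theses.HonestZwanzig.PositiveMemory :=
  fun hGK => positiveMemory_of_greenKuboFloor
    Summit.AtomisticToContinuum.FouriersLaw.Theorems.HonestZwanzig.stub_feshbachIdentities hOO hGK

/-- **`MemoryConductivity → EventualGreenKuboFloor`**: the route's conclusion node gives the floor with `κ = k/2`. -/
theorem eventualFloor_of_memoryConductivity
    (hMC : Summit.AtomisticToContinuum.FouriersLaw.Theses.HonestZwanzig.MemoryConductivity) :
    (∀ ω₂ lam β γ : ℝ, 0 < ω₂ → 0 < lam → 0 < β → 0 < γ → ∀ T : ℝ, 0 < T →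
      ∃ κ : ℝ, 0 < κ ∧ ∃ N₀ : ℕ, ∀ N : ℕ, N₀ ≤ N → 2 ≤ N →
      let P := Literature.MathematicalPhysics.KineticTheory.HeatConduction.pinnedChain ω₂ lam β γ;
      let X := Literature.MathematicalPhysics.KineticTheory.HeatConduction.PhaseSpace N;
      let μ : MeasureTheory.Measure X := P.gibbsMeasure N T;
      let J : X → ℝ := fun z => ∑ i : Fin N, P.bondCurrent N i z;
      κ * ((N : ℝ) - 1) ≤ ∫ t in Set.Ioi (0 : ℝ),
        ((∫ z, J z * (∫ y, J y ∂(P.transitionKernel N T T t.toNNReal z)) ∂μ) - (∫ z, J z ∂μ) * (∫ z, J z ∂μ))) := by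
  intro ω₂ lam β γ hω hl hβ hγ T hT
  obtain ⟨k, hk, hlim⟩ := hMC ω₂ lam β γ hω hl hβ hγ T hT
  have hev := (tendsto_order.1 hlim).1 (k / 2) (by linarith)
  rw [Filter.eventually_atTop] at hev
  obtain ⟨N₁, hN₁⟩ := hev
  refine ⟨k / 2, by positivity, N₁, fun N hN1 hN2 => ?_⟩
  have h := hN₁ N hN1
  dsimp only at h ⊢
  have hpos : (0 : ℝ) < (N : ℝ) - 1 := by
    have : (2 : ℝ) ≤ N := by exact_mod_cast hN2
    linarith
  rw [lt_div_iff₀ hpos] at h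
  exact h.le

/-- **`OrthogonalOhm → PositiveMemory → RobinCoercivity → EventualGreenKuboFloor`**: the three cruxes give the route's
conclusion node by the landed `NetworkReduction` (fed the landed `GeneratorSiteEnergy`, `ParityStatics`,
`FeshbachIdentities`), hence the floor. -/
theorem eventualFloor_of_cruxes
    (hOO : Summit.AtomisticToContinuum.FouriersLaw.Theses.HonestZwanzig.OrthogonalOhm)
    (hPM : Summit.AtomisticToContinuum.FouriersLaw.Theses.HonestZwanzig.PositiveMemory)
    (hRC : Summit.AtomisticToContinuum.FouriersLaw.Theses.HonestZwanzig.RobinCoercivity) :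
    (∀ ω₂ lam β γ : ℝ, 0 < ω₂ → 0 < lam → 0 < β → 0 < γ → ∀ T : ℝ, 0 < T →
      ∃ κ : ℝ, 0 < κ ∧ ∃ N₀ : ℕ, ∀ N : ℕ, N₀ ≤ N → 2 ≤ N →
      let P := Literature.MathematicalPhysics.KineticTheory.HeatConduction.pinnedChain ω₂ lam β γ;
      let X := Literature.MathematicalPhysics.KineticTheory.HeatConduction.PhaseSpace N;
      let μ : MeasureTheory.Measure X := P.gibbsMeasure N T;
      let J : X → ℝ := fun z => ∑ i : Fin N, P.bondCurrent N i z;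
      κ * ((N : ℝ) - 1) ≤ ∫ t in Set.Ioi (0 : ℝ),
        ((∫ z, J z * (∫ y, J y ∂(P.transitionKernel N T T t.toNNReal z)) ∂μ) - (∫ z, J z ∂μ) * (∫ z, J z ∂μ))) :=
  eventualFloor_of_memoryConductivity
    (networkReduction_proof Summit.AtomisticToContinuum.FouriersLaw.Theorems.HonestZwanzig.generatorSiteEnergy_proof
      Summit.AtomisticToContinuum.FouriersLaw.Theorems.HonestZwanzig.parityStatics_proof
      Summit.AtomisticToContinuum.FouriersLaw.Theorems.HonestZwanzig.stub_feshbachIdentities hOO hPM hRC)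

/-- **Given cruxes #2 and #4, crux #3 IS the eventual Green–Kubo floor**: `PositiveMemory ↔ EventualGreenKuboFloor`. -/
theorem positiveMemory_iff_eventualFloor
    (hOO : Summit.AtomisticToContinuum.FouriersLaw.Theses.HonestZwanzig.OrthogonalOhm)
    (hRC : Summit.AtomisticToContinuum.FouriersLaw.Theses.HonestZwanzig.RobinCoercivity) :
    Summit.AtomisticToContinuum.FouriersLaw.Theses.HonestZwanzig.PositiveMemory ↔
    (∀ ω₂ lam β γ : ℝ, 0 < ω₂ → 0 < lam → 0 < β → 0 < γ → ∀ T : ℝ, 0 < T →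
      ∃ κ : ℝ, 0 < κ ∧ ∃ N₀ : ℕ, ∀ N : ℕ, N₀ ≤ N → 2 ≤ N →
      let P := Literature.MathematicalPhysics.KineticTheory.HeatConduction.pinnedChain ω₂ lam β γ;
      let X := Literature.MathematicalPhysics.KineticTheory.HeatConduction.PhaseSpace N;
      let μ : MeasureTheory.Measure X := P.gibbsMeasure N T;
      let J : X → ℝ := fun z => ∑ i : Fin N, P.bondCurrent N i z;
      κ * ((N : ℝ) - 1) ≤ ∫ t in Set.Ioi (0 : ℝ),
        ((∫ z, J z * (∫ y, J y ∂(P.transitionKernel N T T t.toNNReal z)) ∂μ) - (∫ z, J z ∂μ) * (∫ z, J z ∂μ))) :=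
  ⟨fun hPM => eventualFloor_of_cruxes hOO hPM hRC, fun hGK => PositiveMemory_of_eventualFloor hOO hGK⟩

/-- **Necessity of crux #3 given crux #2** (`PositiveMemory_of_memoryConductivity` p120416,
`HonestZwanzig.memoryConductivity_of_fouriersLaw`, `openChainGreenKubo_holds`, all landed): `OrthogonalOhm → FouriersLaw →
PositiveMemory`; hence `¬PositiveMemory → OrthogonalOhm → ¬FouriersLaw` — the crux carries no risk beyond the summit. -/
theorem PositiveMemory_of_fouriersLaw
    (hOO : Summit.AtomisticToContinuum.FouriersLaw.Theses.HonestZwanzig.OrthogonalOhm)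
    (hFL : _root_.FouriersLaw) :
    Summit.AtomisticToContinuum.FouriersLaw.Theses.HonestZwanzig.PositiveMemory :=
  PositiveMemory_of_memoryConductivity hOO
    (Summit.AtomisticToContinuum.FouriersLaw.Theorems.HonestZwanzig.memoryConductivity_of_fouriersLaw
      Summit.AtomisticToContinuum.FouriersLaw.Theorems.OddSectorIrreversibility.Corrector.openChainGreenKubo_holds hFL)

end Summit.AtomisticToContinuum.FouriersLaw.Theorems.HonestZwanzig.PositiveMemory

end
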